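import Mathlib
import HarnessLib
import Summits.HubbardSuperconductivity.HubbardSuperconductivity.Theorems.KLProgrammeC4aPairJetsL1One

/-!
# Route `KLProgramme` — crux C4a, (L3) interface: `CoMovingJetsL1` is additive over FINITE CLASS DECOMPOSITIONS of the vertex — the exact shape S1 + S3 must
# deliver for the tadpole vertex `V_{p₀} − V★` (pp pieces `B(k+q)`, ph-exchange pieces `B(k−q)`, a θ-blind remainder absorbed in `V★`, and a controlled rest)

Cell `gate-hubbard-kl`, lane hubbard-kl-c4a-1 (g5); helper for stub (C) `stub_twoLeg_curvature` of the engine-flow child `KLRegimeEngineV17F2`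
(stmt-HubbardSuperconductivity-20437); memo HOME/hubbard-kl-c4a-1/C4A-PLAN.md §22.9–22.10.  Input (i) of the (A) capstone (`twoLegCurveJetBound_succ_of_inputs_ref`) is ONE
`CoMovingJetsL1 4 (aV p₀) r μ K (tadpoleVertex β 𝒱_n p₀ − V★ p₀)` per kept frequency.  S1 writes that difference as a finite sum of channel pieces; S3 bounds each
piece; this file is the bookkeeping that turns «per-piece dominators» into «one dominator»:

* `CoMovingJetsL1.zero`, **`CoMovingJetsL1.sum`** (finite sums of vertices ↦ sums of dominators);
* `ppJetL`, `ppJetX`, `ppJetY` (defs: the chart ratios of `…C4aPairJetsL1One` as named constants), `coMovingJetsL1_pairSum/pairDiff_of_inversePowerOne'`;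
* **`coMovingJetsL1_of_classDecomposition`**: if `V k q = Σ_{c ∈ s} Bpp c (k + q) + Σ_{c ∈ s'} Bph c (k − q) + Rest k q` with each `Bpp c`, `Bph c` obeying the
  honest inverse-power majorant (`‖DᵏB(p)‖ ≤ Cb c k·(max(c′‖p‖,Λ))⁻¹`, `‖B‖ ≤ Cb0 c`) and `CoMovingJetsL1 4 aR r μ K Rest`, then
  `CoMovingJetsL1 4 (Σ_c ppJetDominatorOne … + Σ_c ppJetDominatorOne … + aR) r μ K V` — frame sizes as in `…C4aPathJets`.

Composition only; nothing about the Hubbard model's sizes; nothing asserts superconductivity.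
References: FST II CPAM 51 (1998) §3; BGM 2006 §2.4 (2.36)–(2.41) [cite: BenfattoGiulianiMastropietro2006].
-/

noncomputable section

namespace Summit.HubbardSuperconductivity.HubbardSuperconductivity.Theorems.C4a

set_option linter.dupNamespace false -- summit = problem name (single-conjunct summit), D-0017

open Real Set MeasureTheory Finset
open scoped ContDiff
open Literature.MathematicalPhysics.QuantumLattice Literature.MathematicalPhysics.QuantumLattice.BandSectorCounting Literature.Probability.LatticeModels
open Summit.HubbardSuperconductivity.HubbardSuperconductivity.Theorems.KLRegimeSplit
open Summit.HubbardSuperconductivity.HubbardSuperconductivity.Theorems.DispersionFlow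
open Summit.HubbardSuperconductivity.HubbardSuperconductivity.Theorems.PerturbedFermiCurve

/-! ## §1 Finite additivity of `CoMovingJetsL1` -/

/-- The zero vertex has zero dominators. -/
theorem CoMovingJetsL1.zero (N : ℕ) (r μ : ℝ) (K : TrigPolyC4v) : CoMovingJetsL1 N (fun _ _ => 0) r μ K (fun _ _ => 0) := by
  refine ⟨fun i _ => integrableOn_const_box r 0, fun θ ρ ϑ _ => ?_⟩
  have hco : coMoving μ K (fun _ _ => (0 : ℂ)) θ ρ (ϑ + θ) = fun _ => 0 := by funext t; simp [coMoving]
  rw [hco]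
  refine ⟨contDiff_const, fun i _ => ?_⟩
  rw [iteratedDeriv_const]; simp

/-- **Finite additivity**: a finite sum of vertices with `CoMovingJetsL1` dominators has the sum of the dominators. -/
theorem CoMovingJetsL1.sum {ι : Type*} (s : Finset ι) {N : ℕ} {r μ : ℝ} {K : TrigPolyC4v} {a : ι → ℕ → ℝ × ℝ → ℝ}
    {V : ι → Momentum → Momentum → ℂ} (h : ∀ c ∈ s, CoMovingJetsL1 N (a c) r μ K (V c)) :
    CoMovingJetsL1 N (fun i p => ∑ c ∈ s, a c i p) r μ K (fun k q => ∑ c ∈ s, V c k q) := by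
  classical
  induction s using Finset.induction_on with
  | empty => simpa using CoMovingJetsL1.zero N r μ K
  | insert c s hc ih =>
    have h1 : CoMovingJetsL1 N (a c) r μ K (V c) := h c (Finset.mem_insert_self c s)
    have h2 := ih fun c' hc' => h c' (Finset.mem_insert_of_mem hc')
    have h3 := h1.add h2
    simp only [Finset.sum_insert hc]
    exact h3

/-! ## §2 Abbreviations for the chart ratios of `…C4aPairJetsL1One` -/

/-- **The path-jet coefficient `L`** of the pp/ph dominators: the max of the radial-row and angular coefficients of orders 1–3 (`d = Dt_min − 2A`). -/
def ppJetL (A A₃ A₄ : ℝ) : ℝ :=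
  max (max (radialRowOneConst A ((bandBounds (show (-4 : ℝ) < -1.1 by norm_num) (show (-1.1 : ℝ) ≤ -0.1 by norm_num) (show (-0.1 : ℝ) < 0 by norm_num)).Dtmin - 2 * A)) (msD A₃ A₄ 2))
    (max (max (uRowTwoConst A A₃ ((bandBounds (show (-4 : ℝ) < -1.1 by norm_num) (show (-1.1 : ℝ) ≤ -0.1 by norm_num) (show (-0.1 : ℝ) < 0 by norm_num)).Dtmin - 2 * A) + 1 / ((bandBounds (show (-4 : ℝ) < -1.1 by norm_num) (show (-1.1 : ℝ) ≤ -0.1 by norm_num) (show (-0.1 : ℝ) < 0 by norm_num)).Dtmin - 2 * A) + 2 * (radialRowOneConst A ((bandBounds (show (-4 : ℝ) < -1.1 by norm_num) (show (-1.1 : ℝ) ≤ -0.1 by norm_num) (show (-0.1 : ℝ) < 0 by norm_num)).Dtmin - 2 * A) - 1 / ((bandBounds (show (-4 : ℝ) < -1.1 by norm_num) (show (-1.1 : ℝ) ≤ -0.1 by norm_num) (show (-0.1 : ℝ) < 0 by norm_num)).Dtmin - 2 * A))) (msD A₃ A₄ 3))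
      (max (uRowThreeConst A A₃ A₄ ((bandBounds (show (-4 : ℝ) < -1.1 by norm_num) (show (-1.1 : ℝ) ≤ -0.1 by norm_num) (show (-0.1 : ℝ) < 0 by norm_num)).Dtmin - 2 * A) + 3 * (radialRowOneConst A ((bandBounds (show (-4 : ℝ) < -1.1 by norm_num) (show (-1.1 : ℝ) ≤ -0.1 by norm_num) (show (-0.1 : ℝ) < 0 by norm_num)).Dtmin - 2 * A) - 1 / ((bandBounds (show (-4 : ℝ) < -1.1 by norm_num) (show (-1.1 : ℝ) ≤ -0.1 by norm_num) (show (-0.1 : ℝ) < 0 by norm_num)).Dtmin - 2 * A)) + 3 * uRowTwoConst A A₃ ((bandBounds (show (-4 : ℝ) < -1.1 by norm_num) (show (-1.1 : ℝ) ≤ -0.1 by norm_num) (show (-0.1 : ℝ) < 0 by norm_num)).Dtmin - 2 * A) + 1 / ((bandBounds (show (-4 : ℝ) < -1.1 by norm_num) (show (-1.1 : ℝ) ≤ -0.1 by norm_num) (show (-0.1 : ℝ) < 0 by norm_num)).Dtmin - 2 * A)) (msD A₃ A₄ 4)))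

/-- **The rigidity/comparability ratio `x = L/(c′·pairSumLowerConst r)`.** -/
def ppJetX (A A₃ A₄ c' r : ℝ) : ℝ := ppJetL A A₃ A₄ / (c' * pairSumLowerConst r)

/-- **The path-jet sup `y = L·(r + π)`.** -/
def ppJetY (A A₃ A₄ r : ℝ) : ℝ := ppJetL A A₃ A₄ * (r + π)

section Sizes

variable {K : TrigPolyC4v} {A : ℝ} (hA : ∀ p : Momentum, ∀ j ≤ 2, ‖iteratedFDeriv ℝ j (frameShift K) p‖ ≤ A) (hA20 : A ≤ 1 / 20)
  (hd : klCurveD ≤ (bandBounds (show (-4 : ℝ) < -1.1 by norm_num) (show (-1.1 : ℝ) ≤ -0.1 by norm_num)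
    (show (-0.1 : ℝ) < 0 by norm_num)).Dtmin - 2 * A)
  {μ r : ℝ} (hr : 0 < r) (hlo : (-1.1 : ℝ) < μ - r - A) (hhi : μ + r + A < -0.1)
  {A₃ A₄ : ℝ} (hA₃ : ∀ p : Momentum, ‖iteratedFDeriv ℝ 3 (frameShift K) p‖ ≤ A₃)
  (hA₄ : ∀ p : Momentum, ‖iteratedFDeriv ℝ 4 (frameShift K) p‖ ≤ A₄)
include hA hA20 hd hr hlo hhi hA₃ hA₄

/-- `coMovingJetsL1_pairSum_of_inversePowerOne` with the abbreviations `ppJetX`, `ppJetY`. -/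
theorem coMovingJetsL1_pairSum_of_inversePowerOne' {Bf : Momentum → ℂ} (hB : ContDiff ℝ 4 Bf) {Cb : ℕ → ℝ} {Cb0 c' Λ : ℝ} (hCb : ∀ k, 0 ≤ Cb k)
    (hc' : 0 < c') (hΛ : 0 < Λ) (hBk : ∀ p : Momentum, ∀ k, 1 ≤ k → k ≤ 4 → ‖iteratedFDeriv ℝ k Bf p‖ ≤ Cb k * (max (c' * ‖p‖) Λ)⁻¹)
    (hB0 : ∀ p : Momentum, ‖Bf p‖ ≤ Cb0) :
    CoMovingJetsL1 4 (fun i _ => ppJetDominatorOne Cb Cb0 (ppJetX A A₃ A₄ c' r) (ppJetY A A₃ A₄ r) Λ (2 * msD A₃ A₄ 4) i) r μ K (fun k q => Bf (k + q)) :=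
  coMovingJetsL1_pairSum_of_inversePowerOne hA hA20 hd hr hlo hhi hA₃ hA₄ hB hCb hc' hΛ hBk hB0

/-- `coMovingJetsL1_pairDiff_of_inversePowerOne` with the abbreviations `ppJetX`, `ppJetY`. -/
theorem coMovingJetsL1_pairDiff_of_inversePowerOne' {Bf : Momentum → ℂ} (hB : ContDiff ℝ 4 Bf) {Cb : ℕ → ℝ} {Cb0 c' Λ : ℝ} (hCb : ∀ k, 0 ≤ Cb k)
    (hc' : 0 < c') (hΛ : 0 < Λ) (hBk : ∀ p : Momentum, ∀ k, 1 ≤ k → k ≤ 4 → ‖iteratedFDeriv ℝ k Bf p‖ ≤ Cb k * (max (c' * ‖p‖) Λ)⁻¹)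
    (hB0 : ∀ p : Momentum, ‖Bf p‖ ≤ Cb0) :
    CoMovingJetsL1 4 (fun i _ => ppJetDominatorOne Cb Cb0 (ppJetX A A₃ A₄ c' r) (ppJetY A A₃ A₄ r) Λ (2 * msD A₃ A₄ 4) i) r μ K (fun k q => Bf (k - q)) :=
  coMovingJetsL1_pairDiff_of_inversePowerOne hA hA20 hd hr hlo hhi hA₃ hA₄ hB hCb hc' hΛ hBk hB0

/-! ## §3 The class decomposition -/

/-- **`CoMovingJetsL1` from a CLASS DECOMPOSITION of the vertex** (the interface S1 + S3 must meet): pp pieces `Bpp c (k+q)`, ph-exchange pieces `Bph c (k−q)` — each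
`C⁴`, bounded by `Cb0· c`, with the honest inverse-power majorant `‖DᵏB(p)‖ ≤ Cb· c k·(max(c′‖p‖,Λ))⁻¹` — plus a rest with its own dominators `aR` ⟹ one
`CoMovingJetsL1 4` statement for `V` with the summed (constant) dominators. [cite: BenfattoGiulianiMastropietro2006, §2.4 (2.36)–(2.41)] -/
theorem coMovingJetsL1_of_classDecomposition {ι ι' : Type*} (s : Finset ι) (s' : Finset ι') {V Rest : Momentum → Momentum → ℂ}
    {Bpp : ι → Momentum → ℂ} {Bph : ι' → Momentum → ℂ} (hV : ∀ k q, V k q = ∑ c ∈ s, Bpp c (k + q) + ∑ c ∈ s', Bph c (k - q) + Rest k q)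
    {c' Λ : ℝ} (hc' : 0 < c') (hΛ : 0 < Λ) {Cbpp : ι → ℕ → ℝ} {Cb0pp : ι → ℝ} {Cbph : ι' → ℕ → ℝ} {Cb0ph : ι' → ℝ}
    (hpp : ∀ c ∈ s, ContDiff ℝ 4 (Bpp c) ∧ (∀ k, 0 ≤ Cbpp c k) ∧ (∀ p, ‖Bpp c p‖ ≤ Cb0pp c) ∧
      ∀ p : Momentum, ∀ k, 1 ≤ k → k ≤ 4 → ‖iteratedFDeriv ℝ k (Bpp c) p‖ ≤ Cbpp c k * (max (c' * ‖p‖) Λ)⁻¹)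
    (hph : ∀ c ∈ s', ContDiff ℝ 4 (Bph c) ∧ (∀ k, 0 ≤ Cbph c k) ∧ (∀ p, ‖Bph c p‖ ≤ Cb0ph c) ∧
      ∀ p : Momentum, ∀ k, 1 ≤ k → k ≤ 4 → ‖iteratedFDeriv ℝ k (Bph c) p‖ ≤ Cbph c k * (max (c' * ‖p‖) Λ)⁻¹)
    {aR : ℕ → ℝ × ℝ → ℝ} (hRest : CoMovingJetsL1 4 aR r μ K Rest) :
    CoMovingJetsL1 4
      (fun i p => (∑ c ∈ s, ppJetDominatorOne (Cbpp c) (Cb0pp c) (ppJetX A A₃ A₄ c' r) (ppJetY A A₃ A₄ r) Λ (2 * msD A₃ A₄ 4) i +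
          ∑ c ∈ s', ppJetDominatorOne (Cbph c) (Cb0ph c) (ppJetX A A₃ A₄ c' r) (ppJetY A A₃ A₄ r) Λ (2 * msD A₃ A₄ 4) i) + aR i p)
      r μ K V := by
  have hVfun : V = fun k q => (∑ c ∈ s, Bpp c (k + q) + ∑ c ∈ s', Bph c (k - q)) + Rest k q := by
    funext k q; rw [hV k q]
  rw [hVfun]
  have hS : CoMovingJetsL1 4 (fun i (_ : ℝ × ℝ) => ∑ c ∈ s, ppJetDominatorOne (Cbpp c) (Cb0pp c) (ppJetX A A₃ A₄ c' r) (ppJetY A A₃ A₄ r) Λ (2 * msD A₃ A₄ 4) i)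
      r μ K (fun k q => ∑ c ∈ s, Bpp c (k + q)) :=
    CoMovingJetsL1.sum s (V := fun c k q => Bpp c (k + q))
      (a := fun c i _ => ppJetDominatorOne (Cbpp c) (Cb0pp c) (ppJetX A A₃ A₄ c' r) (ppJetY A A₃ A₄ r) Λ (2 * msD A₃ A₄ 4) i) fun c hc =>
      coMovingJetsL1_pairSum_of_inversePowerOne' hA hA20 hd hr hlo hhi hA₃ hA₄ (hpp c hc).1 (hpp c hc).2.1 hc' hΛ (hpp c hc).2.2.2 (hpp c hc).2.2.1
  have hS' : CoMovingJetsL1 4 (fun i (_ : ℝ × ℝ) => ∑ c ∈ s', ppJetDominatorOne (Cbph c) (Cb0ph c) (ppJetX A A₃ A₄ c' r) (ppJetY A A₃ A₄ r) Λ (2 * msD A₃ A₄ 4) i)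
      r μ K (fun k q => ∑ c ∈ s', Bph c (k - q)) :=
    CoMovingJetsL1.sum s' (V := fun c k q => Bph c (k - q))
      (a := fun c i _ => ppJetDominatorOne (Cbph c) (Cb0ph c) (ppJetX A A₃ A₄ c' r) (ppJetY A A₃ A₄ r) Λ (2 * msD A₃ A₄ 4) i) fun c hc =>
      coMovingJetsL1_pairDiff_of_inversePowerOne' hA hA20 hd hr hlo hhi hA₃ hA₄ (hph c hc).1 (hph c hc).2.1 hc' hΛ (hph c hc).2.2.2 (hph c hc).2.2.1
  exact (hS.add hS').add hRest

end Sizes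

end Summit.HubbardSuperconductivity.HubbardSuperconductivity.Theorems.C4a

end
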